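import Summits.BirchSwinnertonDyer.BirchSwinnertonDyer.Theorems.AlignedTransportAtTwoMainConjectureTransportAlignedAtTwoDeltaPosCongruence
import Summits.BirchSwinnertonDyer.BirchSwinnertonDyer.Theorems.AlignedTransportAtTwoMainConjectureTransportAlignedAtTwoDeltaPosOddManin
import Literature.NumberTheory.EllipticCurves.ModularJacobianGaloisDataExists
import HarnessLib

/-!
# Crux C1 `MainConjectureTransportAlignedAtTwo` (stmt-BirchSwinnertonDyer-22296), line `birth`, plan «deltapos-galois» (G3) FROM NAMED PRINT FACTS ONLY:
# the equal-conductor `λ`-law of the `Δ > 0` residual with T1 and T4 DISCHARGED — conditional on six PRINT statements that are all tree-named facts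
# (width seat att-p4 g13; `--supports 22296`)

THEOREMS ONLY (no `def`, no `sorry`, no new named fact). BSD is not proved by this; C1 is not closed by this; `stub_lamLawDeltaPos` is NOT discharged
(unequal conductors: att-p3 g14's (G4) capstone). The hypotheses that remain are PRINT and already named in the tree:
`heckeSelfDual_torsionBy_J0` (DDT Lemma 1.38), `buzzard2000_multiplicityOne_gamma0` (Buzzard 2000 Prop. 2.4), `realPeriodRat_eq_unit_mul_plusPeriod_two`
(plus period unit at `2`), `exists_isNewformOf` (modularity), `integral_neronScaling_of_isGloballyMinimal` (Néron mapping property) — the first four are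
crux stubs already —, `nonempty_modularJacobianGaloisData` (T1: `J₀(N)` and the modular parametrisations are defined over `ℚ`, p664932), and an
embedding `ι : ℚ̄ → ℂ` (a parameter; any embedding serves).

* `exists_datum_odd_maninConstant_of_conductorNorm_eq` — `…DeltaPosOddManin.exists_datum_odd_maninConstant` (T4 from PRINT) at a level `N = N(W)` given
  propositionally (to seat both curves' data at one level);
* **`lamLawDeltaPos_of_conductorNorm_eq_of_facts`** — `…DeltaPosCongruence.lamLawDeltaPos_of_conductorNorm_eq` (p669442) with `J` from T1 and `D₁, D₂`
  with odd Manin constants from T4: for the used binders of `stub_lamLawDeltaPos` plus `N(W₁) = N(W₂)`, the conclusion of `stub_lamLawDeltaPos` VERBATIM.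

References: Greenberg–Vatsal 2000 Thm. (1.4); Darmon–Diamond–Taylor 1995 §1.5–§1.7; Buzzard 2000 Prop. 2.4; Abbes–Ullmo 1996 Thm A; Silverman ATAEC IV.5–6.
-/

noncomputable section

-- justification: the `Summit.BirchSwinnertonDyer.BirchSwinnertonDyer.…` path repeats a component (route-file convention)
set_option linter.dupNamespace false
set_option autoImplicit false

open scoped MatrixGroups ModularForm NumberField Classical
open CongruenceSubgroup Complex WeierstrassCurve IsDedekindDomain Polynomial Module
open Literature.NumberTheory.EllipticCurves Literature.NumberTheory.EllipticCurves.ModularForms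
open Literature.NumberTheory.EllipticCurves.Greenberg1999 Literature.NumberTheory.EllipticCurves.GreenbergVatsal2000
open Summit.BirchSwinnertonDyer.Rank1Residual.F1Sign2 Summit.BirchSwinnertonDyer.Rank1Residual.X1.MuLambda
open Summit.BirchSwinnertonDyer.BirchSwinnertonDyer.Theorems.AlignedTransportAtTwoDeltaPosCongruence
open Summit.BirchSwinnertonDyer.BirchSwinnertonDyer.Theorems.AlignedTransportAtTwoDeltaPosOddManin

namespace Summit.BirchSwinnertonDyer.BirchSwinnertonDyer.Theorems.AlignedTransportAtTwoDeltaPosCongruenceOfFacts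

/-- **T4 at a prescribed level.** `…DeltaPosOddManin.exists_datum_odd_maninConstant` with the level `N = N(W)` given propositionally.
[cite: AbbesUllmo1996, Thm. A] [cite: Silverman1994, IV.5–6] -/
theorem exists_datum_odd_maninConstant_of_conductorNorm_eq
    (hmod : exists_isNewformOf) (hNS : integral_neronScaling_of_isGloballyMinimal) (hΩu : realPeriodRat_eq_unit_mul_plusPeriod_two)
    (W : WeierstrassCurve ℚ) [W.IsElliptic] [W.IsGloballyMinimal] (hord : IsOrdinaryAt W 2) (ht : ∀ x : ℚ, ¬ HasRationalTwoTorsionX W x)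
    {N : ℕ} [NeZero N] (hWN : W.conductorNorm ℤ = N) :
    ∃ D : ModularParametrizationData W N, Odd D.c := by
  subst hWN
  exact exists_datum_odd_maninConstant hmod hNS hΩu W hord ht

/-- **The equal-conductor `λ`-law of the `Δ > 0` residual (R1) from named PRINT facts only.** `W₁, W₂` globally minimal, good ordinary at `2`, without
rational `2`-torsion abscissa, `Δ(W₂) ∉ ℚ²`, `W₁` off the Kilford stratum with `Δ(W₁) > 0`, sharing a cubic field with `AlignedAtInfinity`, EQUAL conductors;
newforms `f₁ f₂`, even-branch lifts `G₁ G₂`; PRINT: `hSD`, `hBz`, the plus period unit, modularity, the Néron mapping property, T1; any embedding `ι`.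
Conclusion = that of `stub_lamLawDeltaPos`. [cite: GreenbergVatsal2000, Thm. (1.4)] [cite: DarmonDiamondTaylor1995, §1.5, §1.7 and Lemma 1.38]
[cite: Buzzard2000LevelLoweringModTwo, Prop. 2.4] [cite: AbbesUllmo1996, Thm. A] -/
theorem lamLawDeltaPos_of_conductorNorm_eq_of_facts
    -- PRINT (all tree-named facts)
    (hSD : heckeSelfDual_torsionBy_J0) (hBz : buzzard2000_multiplicityOne_gamma0) (hΩu : realPeriodRat_eq_unit_mul_plusPeriod_two)
    (hmod : exists_isNewformOf) (hNS : integral_neronScaling_of_isGloballyMinimal) (hT1 : nonempty_modularJacobianGaloisData)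
    (ι : AlgebraicClosure ℚ →+* ℂ)
    -- the pair (binders of `stub_lamLawDeltaPos` that are used)
    (W₁ : WeierstrassCurve ℚ) [W₁.IsElliptic] [W₁.IsGloballyMinimal]
    (W₂ : WeierstrassCurve ℚ) [W₂.IsElliptic] [W₂.IsGloballyMinimal]
    (hord₁ : IsOrdinaryAt W₁ 2) (hord₂ : IsOrdinaryAt W₂ 2)
    (ht₁ : ∀ x : ℚ, ¬ HasRationalTwoTorsionX W₁ x) (ht₂ : ∀ x : ℚ, ¬ HasRationalTwoTorsionX W₂ x)
    (hsq₂ : ¬ IsSquare W₂.Δ) (hK : ¬ OnKilfordStratumAtTwo W₁) (hΔ : 0 < W₁.Δ)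
    {F : Type} [Field F] [NumberField F] (hF : finrank ℚ F = 3)
    {e₁ e₂ : F} (he₁ : aeval e₁ (twoDivisionUCubic W₁) = 0) (he₂ : aeval e₂ (twoDivisionUCubic W₂) = 0)
    (hal : AlignedAtInfinity F (twoDivisionUCubic W₁) (twoDivisionUCubic W₂) e₁ e₂)
    [NeZero (W₁.conductorNorm ℤ)] [NeZero (W₂.conductorNorm ℤ)]
    {f₁ : CuspForm (Gamma0 (W₁.conductorNorm ℤ)) 2} (hf₁ : IsNewformOf W₁ f₁)
    {f₂ : CuspForm (Gamma0 (W₂.conductorNorm ℤ)) 2} (hf₂ : IsNewformOf W₂ f₂)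
    {G₁ G₂ : IwasawaAlgebra 2} (hG₁ : IsEvenBranchLiftAtTwo W₁ f₁ G₁) (hG₂ : IsEvenBranchLiftAtTwo W₂ f₂ G₂)
    -- EQUAL CONDUCTORS
    (hN : W₁.conductorNorm ℤ = W₂.conductorNorm ℤ) :
    lam G₁ + ∑ ℓ ∈ (W₁.conductorNorm ℤ * W₂.conductorNorm ℤ).primeFactors.erase 2, lambdaCorrectionAtTwo W₁ ℓ =
      lam G₂ + ∑ ℓ ∈ (W₁.conductorNorm ℤ * W₂.conductorNorm ℤ).primeFactors.erase 2, lambdaCorrectionAtTwo W₂ ℓ := by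
  obtain ⟨J⟩ := hT1 (W₁.conductorNorm ℤ) ι
  obtain ⟨D₁, hc₁⟩ := exists_datum_odd_maninConstant hmod hNS hΩu W₁ hord₁ ht₁
  obtain ⟨D₂, hc₂⟩ := exists_datum_odd_maninConstant_of_conductorNorm_eq hmod hNS hΩu W₂ hord₂ ht₂ hN.symm
  exact lamLawDeltaPos_of_conductorNorm_eq hSD hBz hΩu W₁ W₂ hord₁ hord₂ ht₁ ht₂ hsq₂ hK hΔ hF he₁ he₂ hal hf₁ hf₂ hG₁ hG₂ rfl hN.symm ι J
    D₁ D₂ hc₁ hc₂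

end Summit.BirchSwinnertonDyer.BirchSwinnertonDyer.Theorems.AlignedTransportAtTwoDeltaPosCongruenceOfFacts

end
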